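import Summits.CriticalPhenomena.PercolationContinuityZ3.Theorems.Transplant.SkelPhiRootChainNS3
import Summits.CriticalPhenomena.PercolationContinuityZ3.Theorems.Transplant.SkelPhiRootBridgeKitsFC
import Summits.CriticalPhenomena.PercolationContinuityZ3.Theorems.Transplant.SkelPhiCorridorStepsFC
import Summits.CriticalPhenomena.PercolationContinuityZ3.Theorems.Transplant.SkelPhiRootExcess
import Summits.CriticalPhenomena.PercolationContinuityZ3.Theorems.Transplant.SkelPhiCorridorKGDepth
import HarnessLib

/-!
# N2 (frames-only node `SamePDropOfSkeletonFrm₁`, OPEN), (R) column after J16/(R-38): **THE SECOND-AXIS ROOT LEG OF RECORD, THREE WINDOWS** —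
# `Skelφ.rootChainF_of_bridgeSchedC₃` = `rootChainF_of_bridgeS₃` (SkelPhiRootChainNS3) with every ANALYTIC hypothesis DISCHARGED by its server

HOP → BRIDGE (`B.bridgeFrame hB` in `rootFrame φ t σ`, clause `hkits_bridgeFC`) → x-PREFIX corridor (ANY `Sc₂ : ScheduleNP` through `runX φ c₁ n hs σ₂`,
clause `hkits_schedFC`, route input `hrouteSW₂`) → y′-CORRIDOR (ANY `Sc₃ : ScheduleNP` through `runX φ c₂ n hs σ₃` at a second landing vertex `c₂`, clause
`hkits_schedFC`, route input `hrouteSW₃`), the three windows `planarWindowWin … t Rπ`, law `W0pin (edgesIn (Λc t kz)) U'`, glued by `chainF₃` inside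
`rootChainF_of_bridgeS₃`; both corridors use the SAME run kit `Pk` and level data; chain data built, rim excesses `real_rootRim_le`, nonempty cores from the
two DEPTH ROWS; seed clearances of the corridors in the TWO-DIMENSIONAL form `kb < rootFrame w 0 ∨ kb < rootFrame w 1` (J16).  For the corridors of record:
`hrouteSW₂ := fun hWD => hrouteSW_kgCorr …` (prefix, `Nx ≈ 8–10`), `hrouteSW₃ := fun hWD => hrouteSW_kgCorrY …`.
-- non-vacuity: discharged jointly by the second-axis skeleton `NegB.rootLegAt_frmQ3D_snd` at stmt-g20's values + p5-g16's `kgCorrSchedY_region_bounds` (pending);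
-- N1's `rootOblTWAt_of_inputsG5_y` is the `{±1}` precedent of this very composition (x-prefix + y′-run, NumbersY6 discharged its rows).
builds on p205010 (kernel theorem, internal audit signed; external expert review pending) — nothing in this file uses p205010; nothing here is a
claim about the open node `SamePDropOfSkeletonFrm₁`.
Lane `prim-bschramm`, seat `prim-bschramm-p3` (gen 16; N2 design owner, (R) column owner); helper file (`--supports stmt-CriticalPhenomena-4575 --as helper`).
[cite: KozmaNitzan2024, §4 p. 27 (G₀), p. 28 ((32) at the root), Lemma 10 (pp. 17–21), Lemma 11 (pp. 22–23), Lemma 12 (pp. 23–25)]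
[cite: MartineauSevero2019, Cor. 2.2] [cite: MartineauTassion2017, §4.3 Lemma 4.2]
-/

noncomputable section

open MeasureTheory ProbabilityTheory
open scoped ENNReal Classical

namespace Summit.CriticalPhenomena.PercolationContinuityZ3.Theorems

namespace Transplant

namespace Skelφ

open Literature.Probability.Percolation Literature.Probability.LatticeModels SimpleGraph GadgetSystem ProbeHistory HSiteScheme Contour KNCells
open Literature.Probability.Percolation.KozmaNitzan.Cells (oth sgOf stepVec_apply_fst)
open KNCells.KSchA KNLevels ChainPlanar ChainPara
open Literature.Barriers.CriticalPhenomena (graphBall mem_graphBall_self graphBall_mono)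
open BoxProdZ2 (ConcRadiiG)
open Skel (winGraph)
open SkelI (tanOff)

variable {V : Type} [DecidableEq V] [Countable V] {G : SimpleGraph V} [G.LocallyFinite] {φ ψc : V → Site 2}

/-- **THE SECOND-AXIS ROOT LEG OF RECORD (hop → bridge → x-prefix → y′-corridor), analytic hypotheses discharged** (see the module docstring):
the `RootOblTWF` body at accuracy `δ` with `0 + 1 + Sc₂.N + 1 + Sc₃.N + 1` steps.
[cite: KozmaNitzan2024, §4 p. 28 ((32) at the root), Lemma 10 (pp. 17–21), Lemma 12 (pp. 23–25)] -/
theorem rootChainF_of_bridgeSchedC₃ (hlipφ : Lip G φ) (hstep : Steps G φ) {Δ : ℕ} (hΔ : ∀ v, G.degree v ≤ Δ)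
    (hlipc : Lip G ψc) (hwsc : WeakSteps G ψc)
    -- the cells, the root, the direction, the root frame's sign, the window radius below the concentric radii
    (P : PCells2S) (t : V) (Λ : ConcRadiiG) (b₀ : Fin 2 → ℕ) (q : unitInterval) (δc : ℝ) (du : MDir) {σ : ℤ} (hσ : σ = 1 ∨ σ = -1)
    {Rπ : ℕ} (hRQ : Rπ + 1 ≤ Λ.rQ 0 0) (hRB : Rπ + 1 ≤ Λ.rB 0 0 du) (hRQ' : Rπ + 1 ≤ Λ.rQ 0 ((0 : Site 2) + stepVec du))
    (hRM : Rπ + 1 ≤ Λ.rM 0 ((0 : Site 2) + stepVec du))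
    -- the short region and the zone datum at every centre; THE SEED := the zone at the root (its footprint, its depth, its along-coordinate bound)
    (Rg : V → Finset V) {Rs cU : ℕ} (hRg : ∀ c, ∀ u ∈ Rg c, u ∈ graphBall G c Rs) (hRgcard : ∀ c, (Rg c).card ≤ cU) (hcU1 : 1 ≤ cU)
    (Λc : V → ℕ → Finset V) (kz : ℕ) (hΛRg : ∀ c, Λc c kz ⊆ Rg c) (hzconn : ∀ c, ∀ s ∈ Λc c kz, PathIn G (↑(Λc c kz) : Set V) c s)
    (hcz : ∀ c, c ∈ Λc c kz)
    {ρ : ℕ} (hZρ : ∀ a ∈ Λc t kz, a ∈ graphBall G t ρ) (hρπ : ρ ≤ Rπ)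
    (hZfoot : ∀ a ∈ Λc t kz, -(5 * (P.r du.1 : ℤ)) + 1 ≤ sgOf du * ψc a du.1 ∧ sgOf du * ψc a du.1 ≤ 5 * (P.r du.1 : ℤ) ∧
      |ψc a (oth du.1)| ≤ 5 * (P.r (oth du.1) : ℤ) - 1)
    {kb : ℕ} (hZk : ∀ a ∈ Λc t kz, |rootFrame φ t σ a 0| ≤ kb) (hZk₁ : ∀ a ∈ Λc t kz, |rootFrame φ t σ a 1| ≤ kb)
    -- THE BRIDGE: N1's bridge frame, the bridge kit `Pb` and its slot rows (hp-8's `hkits_bridgeFC`), the stride readings, level data, budget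
    (B : BridgePrm) (hB : BridgeOK B)
    (Pb : ApronPrm) {Mz KCmaxb rsb cSb : ℕ} (hPNb : 1 ≤ Pb.N) (hAb : Pb.A = (Mz : ℤ) + 2)
    (hdDb : Pb.d + 2 ≤ shellD Pb) (hDρb : Rs + 1 ≤ shellD Pb) (hKCmaxb : shellD Pb + Mz + 1 ≤ KCmaxb)
    {Rlev₁ N₁ j₀₁ j₁₁ : ℕ} (hRl₁ : Rlev₁ + 1 ≤ B.R') (hj₁ : j₁₁ ≤ Rlev₁)
    (hwideb : ∀ j, j₀₁ ≤ j → j ≤ j₁₁ → ∀ i, (B.B₀lo - (j : Site 2)) i + 2 * tanOff Pb.ℓs Pb.M ≤ (B.B₀hi + (j : Site 2)) i)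
    (hdwb : ∀ j, j₀₁ ≤ j → j ≤ j₁₁ → ∀ i, (B.B₀lo - (j : Site 2)) i + (Pb.d + 2 : ℕ) ≤ (B.B₀hi + (j : Site 2)) i)
    (hDwb : ∀ j, j₀₁ ≤ j → j ≤ j₁₁ → ∀ i, (B.B₀lo - (j : Site 2)) i + ((shellD Pb + 1 + Pb.d + KCmaxb + Rs : ℕ) : ℤ) ≤ (B.B₀hi + (j : Site 2)) i)
    (hTb : (shellD Pb : ℤ) + KCmaxb + Rs ≤ tanOff Pb.ℓs Pb.M)
    (hr₀b : Pb.N * (tanOff Pb.ℓs Pb.M + 2) + Pb.N * Pb.d + (KCmaxb + Rs) ≤ Pb.r₀) (hRb₀ : Pb.r₀ ≤ Rπ)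
    (hrsb : 1 + (Pb.N * (tanOff Pb.ℓs Pb.M + 2) + Pb.N * Pb.d + (KCmaxb + Rs)) ≤ rsb)
    (hcSb : (Pb.N + 1) * (tanOff Pb.ℓs Pb.M + 1) + (Pb.N + 1) * Pb.d + (KCmaxb + 1) + cU ≤ cSb)
    (hEb : j₁₁ + (Pb.N * (tanOff Pb.ℓs Pb.M + 1) + Pb.N * Pb.d + KCmaxb) ≤ B.R')
    {rb Rb : ℕ} (hreachb : rb + (Pb.N * (tanOff Pb.ℓs Pb.M + 1) + Pb.N * Pb.d + KCmaxb) ≤ Pb.r₀) (hrb : Rb ≤ rb) (hrbR : rb ≤ Rπ)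
    (Qb Fb : V → Finset V)
    (hQb : ∀ c, ∀ w ∈ Qb c, w ∈ graphBall G c Rb ∧
      rootFrame φ t σ w ∈ Finset.Icc (rootFrame φ t σ c - ((B.pr : ℕ) : Site 2)) (rootFrame φ t σ c + ((B.pr : ℕ) : Site 2)))
    (hFb : ∀ c, ∀ w ∈ Fb c, w ∈ Qb c ∧ rootFrame φ t σ w ∈ Finset.Icc (rootFrame φ t σ c + B.dlo) (rootFrame φ t σ c + B.dhi))
    (kk₁ : ℕ) (hkN₁ : kk₁ * (Δ + 1) ^ (2 * rsb) ≤ N₁)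
    -- THE CORRIDOR: the run frame at `c₁`, ANY planar schedule `Sc`, the run kit `Pk` and its slot rows (p5-g16's `hkits_schedFC`), level data, budget,
    -- the depth row (origin depth `D₀`, one radius row over the prism)
    {n : ℕ} {hs : ℤ} (hn : 1 ≤ n) (c₁ : V) {σ₂ : ℤ} (hσ₂ : σ₂ = 1 ∨ σ₂ = -1) {kq : ℕ} (hκL : hs.natAbs ≤ kq * n)
    (Sc₂ : ScheduleNP) (c₂ : V) {σ₃ : ℤ} (hσ₃ : σ₃ = 1 ∨ σ₃ = -1) (Sc₃ : ScheduleNP) {r : ℕ}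
    (Pk : ApronPrm) {KCmax rs cS : ℕ} (hPN : kq + 3 ≤ Pk.N) (hA : Pk.A = (Mz + 1 : ℕ) * (shearUnit n hs : ℤ) + 1)
    (hdD : Pk.d + 2 ≤ shellD Pk) (hDρ : Rs + 1 ≤ shellD Pk) (hKCmax : (shellD Pk + Mz + 1) * (kq + 1) ≤ KCmax)
    (hT : (shellD Pk : ℤ) + KCmax + Rs ≤ tanOff Pk.ℓs Pk.M)
    (hr₀ : Pk.N * (tanOff Pk.ℓs Pk.M + 2) + Pk.N * Pk.d + (KCmax + Rs) ≤ Pk.r₀) (hR : Pk.r₀ ≤ Rπ)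
    (hrs : 1 + (Pk.N * (tanOff Pk.ℓs Pk.M + 2) + Pk.N * Pk.d + (KCmax + Rs)) ≤ rs)
    (hcS : (Pk.N + 1) * (tanOff Pk.ℓs Pk.M + 1) + (Pk.N + 1) * Pk.d + (KCmax + 1) + cU ≤ cS)
    (hreach : r + (Pk.N * (tanOff Pk.ℓs Pk.M + 1) + Pk.N * Pk.d + KCmax) ≤ Pk.r₀)
    {Rlev₂ N₂ j₀₂ j₁₂ : ℕ} (hj0 : tanOff Pk.ℓs Pk.M ≤ j₀₂) (hj₂ : j₁₂ ≤ Rlev₂) (hRl₂ : Rlev₂ + 1 ≤ Sc₂.R') (hRl₃ : Rlev₂ + 1 ≤ Sc₃.R')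
    (hE : j₁₂ + (Pk.N * (tanOff Pk.ℓs Pk.M + 1) + Pk.N * Pk.d + KCmax) ≤ Sc₂.R')
    (hE₃ : j₁₂ + (Pk.N * (tanOff Pk.ℓs Pk.M + 1) + Pk.N * Pk.d + KCmax) ≤ Sc₃.R')
    (kk₂ : ℕ) (hkN₂ : kk₂ * (Δ + 1) ^ (2 * rs) ≤ N₂)
    {D₀ : ℕ} (hc₁ : c₁ ∈ graphBall G t D₀) (hRdepth : ∀ z ∈ Sc₂.prism, D₀ + (kq + 3) * ((z 0).natAbs + (z 1).natAbs) ≤ Rπ)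
    {D₀' : ℕ} (hc₂ : c₂ ∈ graphBall G t D₀') (hRdepth₃ : ∀ z ∈ Sc₃.prism, D₀' + (kq + 3) * ((z 0).natAbs + (z 1).natAbs) ≤ Rπ)
    -- ROOMS: footprints of the bridge region / the corridor regions / the last core, clearances of the seed, the bridge target nonempty, the cross link
    (hfoot₁ : ∀ w ∈ graphBall G t Rπ, rootFrame φ t σ w ∈ Finset.Icc B.regionLo B.regionHi → RootFootS P du (ψc w))
    (hfoot₂ : ∀ k ≤ Sc₂.N, ∀ w ∈ graphBall G t Rπ, runX φ c₁ n hs σ₂ w ∈ Sc₂.region k → RootFootS P du (ψc w))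
    (hfoot₃ : ∀ k ≤ Sc₃.N, ∀ w ∈ graphBall G t Rπ, runX φ c₂ n hs σ₃ w ∈ Sc₃.region k → RootFootS P du (ψc w))
    (hclear₁ : (kb : ℤ) < B.B₀lo 0 - B.R' - B.pr)
    (hclear₂ : ∀ k ≤ Sc₂.N, ∀ w ∈ graphBall G t Rπ, runX φ c₁ n hs σ₂ w ∈ Sc₂.region k → (kb : ℤ) < rootFrame φ t σ w 0 ∨ (kb : ℤ) < rootFrame φ t σ w 1)
    (hclear₃ : ∀ k ≤ Sc₃.N, ∀ w ∈ graphBall G t Rπ, runX φ c₂ n hs σ₃ w ∈ Sc₃.region k → (kb : ℤ) < rootFrame φ t σ w 0 ∨ (kb : ℤ) < rootFrame φ t σ w 1)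
    (hTne₁ : (Win G (rootFrame φ t σ) t (Finset.Icc B.core1Lo B.core1Hi) Rπ).Nonempty)
    (hx : ∀ w ∈ graphBall G t Rπ, rootFrame φ t σ w ∈ Finset.Icc B.core1Lo B.core1Hi → runX φ c₁ n hs σ₂ w ∈ ScheduleNP.core Sc₂ 0)
    (hx₂ : ∀ w ∈ graphBall G t Rπ, runX φ c₁ n hs σ₂ w ∈ ScheduleNP.core Sc₂ (Sc₂.N + 1) → runX φ c₂ n hs σ₃ w ∈ ScheduleNP.core Sc₃ 0)
    (hlastf : ∀ w ∈ graphBall G t Rπ, runX φ c₂ n hs σ₃ w ∈ ScheduleNP.core Sc₃ (Sc₃.N + 1) → TargetFootS P b₀ du (ψc w))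
    -- accuracy; THE HOP (a route input valid for `P_q`) with its prism rows; counts; kit budgets
    {Δ' : ℕ} {δ η : ℝ} (hδ : 0 < δ) (hη : η ≤ δ / 2) {Qp T₀ : Finset V}
    (hlink : 1 - δ < (bondPercolation G q).real (linkIn (↑Qp : Set V) (Λc t kz) T₀))
    (hQπ : ∀ w ∈ Qp, w ∈ graphBall G t Rπ) (hQfoot : ∀ w ∈ Qp, RootFootS P du (ψc w))
    (hT₀ : ∀ w ∈ T₀, w ∈ graphBall G t Rπ ∧ rootFrame φ t σ w ∈ Finset.Icc B.B₀lo B.B₀hi)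
    (hcount₁ : 1 / (1 - (q : ℝ)) ^ (Δ' * N₁) ≤ δ * ((Finset.Icc j₀₁ j₁₁).card : ℝ))
    (hcount₂ : 1 / (1 - (q : ℝ)) ^ (Δ' * N₂) ≤ δ * ((Finset.Icc j₀₂ j₁₂).card : ℝ))
    (hk₁ : (1 - (q : ℝ) ^ (1 + Δ * cSb + cSb * cU)) ^ kk₁ ≤ δ) (hk₂ : (1 - (q : ℝ) ^ (1 + Δ * cS + cS * cU)) ^ kk₂ ≤ δ)
    -- THE ROUTE INPUTS AT EVERY CENTRE: the bridge event at accuracy `δ³` for `P_q`; the corridor's parked-or-routed input for every sub-box law on the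
    -- region windows (for the K-G corridor: `fun hWD => hrouteSW_kgCorr … hWD Λc kz hlong hlongY`)
    (hbridge : ∀ c, 1 - δ ^ 3 < (bondPercolation G q).real (linkIn (↑(Qb c) : Set V) (Λc c kz) (Fb c)))
    (hrouteSW₂ : ∀ {W' : Sym2 V → unitInterval},
      (∀ k ≤ Sc₂.N, IsSubbox (winGraph G t Rπ) W' q (Win G (runX φ c₁ n hs σ₂) t (Sc₂.region k) Rπ)) →
      ∀ k ≤ Sc₂.N, ∀ c : V,
        runX φ c₁ n hs σ₂ c ∈ Finset.Icc (Sc₂.lo k - ((Sc₂.R' : ℕ) : Site 2)) (Sc₂.hi k + ((Sc₂.R' : ℕ) : Site 2)) → c ∈ graphBall G t (Rπ - r) →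
        c ∈ Win G (runX φ c₁ n hs σ₂) t (ScheduleNP.core Sc₂ (k + 1)) Rπ ∪ rootRim (G := G) t Rπ Pk.r₀ (Win G (runX φ c₁ n hs σ₂) t (Sc₂.region k) Rπ) ∨
        ∃ Qt Ft : Finset V, Ft ⊆ Win G (runX φ c₁ n hs σ₂) t (ScheduleNP.core Sc₂ (k + 1)) Rπ ∪ rootRim (G := G) t Rπ Pk.r₀ (Win G (runX φ c₁ n hs σ₂) t (Sc₂.region k) Rπ) ∧
          Qt ⊆ Win G (runX φ c₁ n hs σ₂) t (Sc₂.region k) Rπ ∧ 1 - δ ^ 3 ≤ (prodBernoulli W').real (linkIn (↑Qt : Set V) (Λc c kz) Ft))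
    (hrouteSW₃ : ∀ {W' : Sym2 V → unitInterval},
      (∀ k ≤ Sc₃.N, IsSubbox (winGraph G t Rπ) W' q (Win G (runX φ c₂ n hs σ₃) t (Sc₃.region k) Rπ)) →
      ∀ k ≤ Sc₃.N, ∀ c : V,
        runX φ c₂ n hs σ₃ c ∈ Finset.Icc (Sc₃.lo k - ((Sc₃.R' : ℕ) : Site 2)) (Sc₃.hi k + ((Sc₃.R' : ℕ) : Site 2)) → c ∈ graphBall G t (Rπ - r) →
        c ∈ Win G (runX φ c₂ n hs σ₃) t (ScheduleNP.core Sc₃ (k + 1)) Rπ ∪ rootRim (G := G) t Rπ Pk.r₀ (Win G (runX φ c₂ n hs σ₃) t (Sc₃.region k) Rπ) ∨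
        ∃ Qt Ft : Finset V, Ft ⊆ Win G (runX φ c₂ n hs σ₃) t (ScheduleNP.core Sc₃ (k + 1)) Rπ ∪ rootRim (G := G) t Rπ Pk.r₀ (Win G (runX φ c₂ n hs σ₃) t (Sc₃.region k) Rπ) ∧
          Qt ⊆ Win G (runX φ c₂ n hs σ₃) t (Sc₃.region k) Rπ ∧ 1 - δ ^ 3 ≤ (prodBernoulli W').real (linkIn (↑Qt : Set V) (Λc c kz) Ft))
    -- THE RIM EXCESS DEVICE (N1's `exists_excess_radius_uniform` conclusion at `q`, entrance depth `ρ + 1`, planar diameter `m` in a map `φe`), below both rims;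
    -- the planar diameter of the cut world
    {φe : V → Site 2} {m R₁ : ℕ}
    (hR₁ : ∀ R', R₁ ≤ R' → ∀ (Rw : ℕ) (D' B' : Finset V), (∀ d ∈ D', d ∈ graphBall G t Rw) →
      (∀ d ∈ D', ∀ d' ∈ D', φe d - φe d' ∈ box 2 m) → B' ⊆ D' → (∀ a ∈ B', a ∈ graphBall G t (ρ + 1)) →
        (bondPercolation G q).real (Skel.excess G t R' D' B') ≤ η)
    (hR₁b : R₁ ≤ Rπ - Pb.r₀) (hR₁r : R₁ ≤ Rπ - Pk.r₀)
    (hDm : ∀ d ∈ ((((⟨cellGeomSG₂bS G ψc P t Λ b₀, q, δc⟩ : KSchA V ℕ).U0root du).filter fun y => y ∈ graphBall G t Rπ) \ Λc t kz),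
      ∀ d' ∈ ((((⟨cellGeomSG₂bS G ψc P t Λ b₀, q, δc⟩ : KSchA V ℕ).U0root du).filter fun y => y ∈ graphBall G t Rπ) \ Λc t kz), φe d - φe d' ∈ box 2 m) :
    ∃ (c : V) (R₀ : ℕ) (W : Sym2 V → unitInterval) (s : Fin ((B.bridgeFrame hB).N + 1 + Sc₂.toFrame.N + 1 + Sc₃.toFrame.N + 1) → KNLevels.TStep (winGraph G c R₀))
      (T' : Fin ((B.bridgeFrame hB).N + 1 + Sc₂.toFrame.N + 1 + Sc₃.toFrame.N + 1) → Finset V) (η' : ℝ),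
      (∀ T : Finset V, (prodBernoulli W).real (⋃ t' ∈ T, openConn t t') ≤
        (prodBernoulli (pinW (KNLevels.lattW G q) ↑((⟨cellGeomSG₂bS G ψc P t Λ b₀, q, δc⟩ : KSchA V ℕ).U₀ G)
          ↑((⟨cellGeomSG₂bS G ψc P t Λ b₀, q, δc⟩ : KSchA V ℕ).U₀ G))).real
          (⋃ t' ∈ (↑T : Set V), openConnIn (↑((cellGeomSG₂bS G ψc P t Λ b₀).Q 0 0 ∪ (cellGeomSG₂bS G ψc P t Λ b₀).Ewv 0 0 du) : Set V) t t')) ∧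
      (∀ i : Fin ((B.bridgeFrame hB).N + 1 + Sc₂.toFrame.N + 1 + Sc₃.toFrame.N + 1), (s i).L.o = t) ∧
      (∀ i : Fin ((B.bridgeFrame hB).N + 1 + Sc₂.toFrame.N + 1 + Sc₃.toFrame.N), T' (Fin.castSucc i) ⊆ (s i.succ).L.X 0) ∧
      (∀ i : Fin ((B.bridgeFrame hB).N + 1 + Sc₂.toFrame.N + 1 + Sc₃.toFrame.N + 1), T' i ⊆ (s i).T) ∧
      (∀ i : Fin ((B.bridgeFrame hB).N + 1 + Sc₂.toFrame.N + 1 + Sc₃.toFrame.N + 1), (s i).KitsAtF W q Δ' δ) ∧ η' ≤ δ / 2 ∧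
      (∀ i : Fin ((B.bridgeFrame hB).N + 1 + Sc₂.toFrame.N + 1 + Sc₃.toFrame.N + 1), (prodBernoulli W).real (⋃ t' ∈ (s i).T \ T' i, openConn t t') ≤ η') ∧
      1 - δ < (prodBernoulli W).real (s 0).L.reachB ∧
      T' (Fin.last ((B.bridgeFrame hB).N + 1 + Sc₂.toFrame.N + 1 + Sc₃.toFrame.N)) ⊆ (cellGeomSG₂bS G ψc P t Λ b₀).M 0 ((0 : Site 2) + stepVec du) := by
  set S : KSchA V ℕ := ⟨cellGeomSG₂bS G ψc P t Λ b₀, q, δc⟩ with hSdef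
  set A : Finset V := Λc t kz with hAdef
  set U' : Finset V := (S.U0root du).filter fun y => y ∈ graphBall G t Rπ with hU'
  set ψL := runX φ c₁ n hs σ₂ with hψL
  set ψ₃ := runX φ c₂ n hs σ₃ with hψ₃
  have hlipL : Lip G ψL := lip_runX hlipφ hσ₂ hn c₁ hs
  have hlipL₃ : Lip G ψ₃ := lip_runX hlipφ hσ₃ hn c₂ hs
  set 𝒲₁ := planarWindowWin (lip_rootFrame hlipφ t hσ) t Rπ with h𝒲₁
  set 𝒲₂ := planarWindowWin (lip_runX hlipφ hσ₂ hn c₁ hs) t Rπ with h𝒲₂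
  set 𝒲₃ := planarWindowWin (lip_runX hlipφ hσ₃ hn c₂ hs) t Rπ with h𝒲₃
  set S₁ := B.bridgeFrame hB with hS₁
  set S₂ : SchedFrame := Sc₂.toFrame with hS₂
  set S₃ : SchedFrame := Sc₃.toFrame with hS₃
  -- the chain data: rims are the far parts of the region windows
  set P₁ : WinChainData V := ⟨Rlev₁, N₁, j₀₁, j₁₁, t, U', fun k => rootRim (G := G) t Rπ Pb.r₀ (𝒲₁.stepDF S₁ k)⟩ with hP₁
  set P₂ : WinChainData V := ⟨Rlev₂, N₂, j₀₂, j₁₂, t, U', fun k => rootRim (G := G) t Rπ Pk.r₀ (𝒲₂.stepDF S₂ k)⟩ with hP₂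
  set P₃ : WinChainData V := ⟨Rlev₂, N₂, j₀₂, j₁₂, t, U', fun k => rootRim (G := G) t Rπ Pk.r₀ (𝒲₃.stepDF S₃ k)⟩ with hP₃
  have hpq : S.p = q := rfl
  -- seed rows
  have htA : t ∈ A := hcz t
  have hAπ : ∀ a ∈ A, a ∈ graphBall G t Rπ := fun a ha => graphBall_mono G t hρπ (hZρ a ha)
  -- footprints ⟹ the root world
  have hU : ∀ {w : V}, w ∈ graphBall G t Rπ → RootFootS P du (ψc w) → w ∈ U' := by
    intro w hw hf
    exact Finset.mem_filter.2 ⟨mem_U0rootS_of_footprint P t Λ b₀ q δc du hlipc hwsc hRQ hRB hRQ' hw hf.1 hf.2.1 hf.2.2, hw⟩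
  have hDU₁ : ∀ k ≤ S₁.N, 𝒲₁.stepDF S₁ k ⊆ U' := by
    intro k hk w hw
    obtain rfl : k = 0 := Nat.le_zero.1 hk
    change w ∈ Win G (rootFrame φ t σ) t (S₁.region 0) Rπ at hw
    rw [mem_Win] at hw
    exact hU hw.1 (hfoot₁ w hw.1 (by simpa [hS₁] using hw.2))
  have hDU₂ : ∀ k ≤ S₂.N, 𝒲₂.stepDF S₂ k ⊆ U' := by
    intro k hk w hw
    change w ∈ Win G ψL t (S₂.region k) Rπ at hw
    rw [mem_Win] at hw
    exact hU hw.1 (hfoot₂ k hk w hw.1 hw.2)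
  have hDU₃ : ∀ k ≤ S₃.N, 𝒲₃.stepDF S₃ k ⊆ U' := by
    intro k hk w hw
    change w ∈ Win G ψ₃ t (S₃.region k) Rπ at hw
    rw [mem_Win] at hw
    exact hU hw.1 (hfoot₃ k hk w hw.1 hw.2)
  have hDA₁ : ∀ k ≤ S₁.N, Disjoint (𝒲₁.stepDF S₁ k) A := by
    intro k hk
    obtain rfl : k = 0 := Nat.le_zero.1 hk
    change Disjoint (Win G (rootFrame φ t σ) t (S₁.region 0) Rπ) A
    refine Finset.disjoint_left.2 fun w hw hwA => ?_
    rw [mem_Win] at hw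
    have h1 : B.B₀lo 0 - B.R' - B.pr ≤ rootFrame φ t σ w 0 := BridgePrm.le_of_mem_region (by simpa [hS₁] using hw.2) 0
    have h2 := (abs_le.1 (hZk w hwA)).2
    linarith
  have hDA₂ : ∀ k ≤ S₂.N, Disjoint (𝒲₂.stepDF S₂ k) A := by
    intro k hk
    change Disjoint (Win G ψL t (S₂.region k) Rπ) A
    refine Finset.disjoint_left.2 fun w hw hwA => ?_
    rw [mem_Win] at hw
    rcases hclear₂ k hk w hw.1 hw.2 with h1 | h1
    · have h2 := (abs_le.1 (hZk w hwA)).2; linarith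
    · have h2 := (abs_le.1 (hZk₁ w hwA)).2; linarith
  have hDA₃ : ∀ k ≤ S₃.N, Disjoint (𝒲₃.stepDF S₃ k) A := by
    intro k hk
    change Disjoint (Win G ψ₃ t (S₃.region k) Rπ) A
    refine Finset.disjoint_left.2 fun w hw hwA => ?_
    rw [mem_Win] at hw
    rcases hclear₃ k hk w hw.1 hw.2 with h1 | h1
    · have h2 := (abs_le.1 (hZk w hwA)).2; linarith
    · have h2 := (abs_le.1 (hZk₁ w hwA)).2; linarith
  -- the sub-box weightings of the region windows under the root-seed law
  have hFA : ∀ e ∈ edgesIn G A, ∀ w ∈ e, w ∈ A := fun e he w hw => ((mem_edgesIn_iff).1 he).2 w hw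
  have hWD₁ : ∀ k ≤ S₁.N, IsSubbox (winGraph G t Rπ) (S.W0pin G (edgesIn G A) U') S.p (𝒲₁.stepDF S₁ k) := fun k hk =>
    Skel.isSubbox_W0pin_win (S := S) t Rπ (U := S.U0root du) (hDU₁ k hk) (KSchA.fresh_of_disjoint hFA (hDA₁ k hk))
  have hWD₂ : ∀ k ≤ Sc₂.N, IsSubbox (winGraph G t Rπ) (S.W0pin G (edgesIn G A) U') q (Win G ψL t (Sc₂.region k) Rπ) := fun k hk =>
    Skel.isSubbox_W0pin_win (S := S) t Rπ (U := S.U0root du) (hDU₂ k hk) (KSchA.fresh_of_disjoint hFA (hDA₂ k hk))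
  have hWD₃ : ∀ k ≤ Sc₃.N, IsSubbox (winGraph G t Rπ) (S.W0pin G (edgesIn G A) U') q (Win G ψ₃ t (Sc₃.region k) Rπ) := fun k hk =>
    Skel.isSubbox_W0pin_win (S := S) t Rπ (U := S.U0root du) (hDU₃ k hk) (KSchA.fresh_of_disjoint hFA (hDA₃ k hk))
  -- rim excesses
  have hexc₁ : ∀ k ≤ S₁.N, (prodBernoulli (S.W0pin G (edgesIn G A) U')).real (⋃ t' ∈ P₁.Rim k, openConn t t') ≤ η := fun k hk =>
    real_rootRim_le (S := S) (du := du) htA hZρ (hDU₁ k hk) (hDA₁ k hk) hR₁ hR₁b hDm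
  have hexc₂ : ∀ k ≤ S₂.N, (prodBernoulli (S.W0pin G (edgesIn G A) U')).real (⋃ t' ∈ P₂.Rim k, openConn t t') ≤ η := fun k hk =>
    real_rootRim_le (S := S) (du := du) htA hZρ (hDU₂ k hk) (hDA₂ k hk) hR₁ hR₁r hDm
  have hexc₃ : ∀ k ≤ S₃.N, (prodBernoulli (S.W0pin G (edgesIn G A) U')).real (⋃ t' ∈ P₃.Rim k, openConn t t') ≤ η := fun k hk =>
    real_rootRim_le (S := S) (du := du) htA hZρ (hDU₃ k hk) (hDA₃ k hk) hR₁ hR₁r hDm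
  -- the corridor's core windows are nonempty: a vertex of the run frame over each core point, within the window ball by the depth row
  have hTne₂ : ∀ k ≤ S₂.N, (Win G ψL t (S₂.core (k + 1)) Rπ).Nonempty := by
    intro k hk
    obtain ⟨z, hz⟩ := Sc₂.nonempty (k + 1) (by change k ≤ Sc₂.N at hk; omega)
    have hzP : z ∈ Sc₂.prism := Sc₂.sub_prism k hk (Sc₂.succ k hk hz)
    obtain ⟨g, hg, hgz⟩ := QStepsN.exists_mem_graphBall_eq (qStepsN_runX hstep hn c₁ hs hσ₂ hκL) c₁ z
    rw [runX_origin] at hg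
    simp only [Pi.zero_apply, sub_zero] at hg
    have hgw : g ∈ graphBall G t (D₀ + (kq + 3) * ((z 0).natAbs + (z 1).natAbs)) := BoxProdZ2.mem_graphBall_add G hc₁ hg
    have hgR : g ∈ graphBall G t Rπ := graphBall_mono G _ (hRdepth z hzP) hgw
    exact ⟨g, (mem_Win (G := G) (φ := ψL)).2 ⟨hgR, by rw [hψL, hgz]; exact hz⟩⟩
  have hTne₃ : ∀ k ≤ S₃.N, (Win G ψ₃ t (S₃.core (k + 1)) Rπ).Nonempty := by
    intro k hk
    obtain ⟨z, hz⟩ := Sc₃.nonempty (k + 1) (by change k ≤ Sc₃.N at hk; omega)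
    have hzP : z ∈ Sc₃.prism := Sc₃.sub_prism k hk (Sc₃.succ k hk hz)
    obtain ⟨g, hg, hgz⟩ := QStepsN.exists_mem_graphBall_eq (qStepsN_runX hstep hn c₂ hs hσ₃ hκL) c₂ z
    rw [runX_origin] at hg
    simp only [Pi.zero_apply, sub_zero] at hg
    have hgw : g ∈ graphBall G t (D₀' + (kq + 3) * ((z 0).natAbs + (z 1).natAbs)) := BoxProdZ2.mem_graphBall_add G hc₂ hg
    have hgR : g ∈ graphBall G t Rπ := graphBall_mono G _ (hRdepth₃ z hzP) hgw
    exact ⟨g, (mem_Win (G := G) (φ := ψ₃)).2 ⟨hgR, by rw [hψ₃, hgz]; exact hz⟩⟩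
  -- the kits of the bridge step (hp-8's `hkits_bridgeFC`)
  have hkits₁ : ∀ k ≤ (B.bridgeFrame hB).N, ∀ j ∈ Finset.Icc P₁.j₀ P₁.j₁, ∃ (σk : SData V) (Sz : Finset V),
      SHyp (P₁.stepLF 𝒲₁ (B.bridgeFrame hB) k) j σk ∧ σk.N ≤ P₁.N ∧ (1 - (q : ℝ) ^ σk.sB) ^ σk.k ≤ δ ∧
      Sz ⊆ 𝒲₁.stepDF (B.bridgeFrame hB) k ∧ (∀ x ∈ σk.K, σk.face x ⊆ Sz) ∧
      RelayClause (P₁.stepLF 𝒲₁ (B.bridgeFrame hB) k) (S.W0pin G (edgesIn G A) U') j σk Sz (P₁.coreEF 𝒲₁ (B.bridgeFrame hB) k)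
        (𝒲₁.stepDF (B.bridgeFrame hB) k) δ := by
    intro k hk j hj
    obtain rfl : k = 0 := Nat.le_zero.1 hk
    have hjge : j₀₁ ≤ j := (Finset.mem_Icc.1 hj).1
    have hjle : j ≤ j₁₁ := (Finset.mem_Icc.1 hj).2
    have hXD : winLevel G (rootFrame φ t σ) t Rπ B.B₀lo B.B₀hi j ⊆ 𝒲₁.stepDF S₁ 0 := by
      change Win G (rootFrame φ t σ) t (Finset.Icc (B.B₀lo - (j : Site 2)) (B.B₀hi + (j : Site 2))) Rπ ⊆ Win G (rootFrame φ t σ) t (S₁.region 0) Rπ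
      refine Win_mono G _ ?_ le_rfl
      rw [hS₁, BridgePrm.bridgeFrame_region]
      exact (S₁.icc_enlarge_mono 0 (show j ≤ B.R' by omega)).trans BridgePrm.enl_subset_region
    have hPD : Win G (rootFrame φ t σ) t (Finset.Icc B.regionLo B.regionHi) Rπ ⊆ 𝒲₁.stepDF S₁ 0 := subset_rfl
    have hPT : Win G (rootFrame φ t σ) t (Finset.Icc B.core1Lo B.core1Hi) Rπ ⊆ P₁.coreEF 𝒲₁ S₁ 0 := Finset.subset_union_left
    have hfarT : ∀ v ∈ winLevel G (rootFrame φ t σ) t Rπ B.B₀lo B.B₀hi j, v ∉ graphBall G t (Rπ - Pb.r₀) → v ∈ P₁.coreEF 𝒲₁ S₁ 0 :=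
      fun v hv hfar => Finset.mem_union_right _ (Finset.mem_filter.2 ⟨hXD hv, hfar⟩)
    exact hkits_bridgeFC hlipφ hstep hΔ hδ t hσ B Pb hPNb hAb hdDb hDρb hKCmaxb (hwideb j hjge hjle) (hdwb j hjge hjle) (hDwb j hjge hjle) hTb hr₀b hRb₀ hrsb hcSb
      (le_trans (by omega) hEb) hreachb hrb hrbR Rg hRg hRgcard hcU1 Λc kz hΛRg hzconn hcz Qb Fb hQb hFb kk₁ t U' (hWD₁ 0 le_rfl) hPD hXD hPT
      hfarT hkN₁ hk₁ hbridge
  -- the kits of the corridor (p5-g16's `hkits_schedFC` fed by the route input under the root-seed law)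
  have hj1R : P₂.j₁ ≤ Sc₂.R' := show j₁₂ ≤ Sc₂.R' by omega
  have hcover : ∀ k ≤ Sc₂.N, ∀ v ∈ Win G (runX φ c₁ n hs σ₂) t (Sc₂.region k) Rπ, v ∉ graphBall G t (Rπ - Pk.r₀) → v ∈ P₂.Rim k :=
    fun k _ v hv hfar => Finset.mem_filter.2 ⟨hv, hfar⟩
  have hkits₂ := hkits_schedFC hlipφ hstep hΔ hδ hn c₁ hs hσ₂ hκL Sc₂ Pk hPN hA hdD hDρ hKCmax hT hr₀ hR hrs hcS hreach Rg hRg hRgcard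
    hcU1 Λc kz hΛRg hzconn hcz P₂ hj0 hj1R hE kk₂ hkN₂ hk₂ hcover (hrouteSW₂ hWD₂)
  have hj1R₃ : P₃.j₁ ≤ Sc₃.R' := show j₁₂ ≤ Sc₃.R' by omega
  have hcover₃ : ∀ k ≤ Sc₃.N, ∀ v ∈ Win G (runX φ c₂ n hs σ₃) t (Sc₃.region k) Rπ, v ∉ graphBall G t (Rπ - Pk.r₀) → v ∈ P₃.Rim k :=
    fun k _ v hv hfar => Finset.mem_filter.2 ⟨hv, hfar⟩
  have hkits₃ := hkits_schedFC hlipφ hstep hΔ hδ hn c₂ hs hσ₃ hκL Sc₃ Pk hPN hA hdD hDρ hKCmax hT hr₀ hR hrs hcS hreach Rg hRg hRgcard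
    hcU1 Λc kz hΛRg hzconn hcz P₃ hj0 hj1R₃ hE₃ kk₂ hkN₂ hk₂ hcover₃ (hrouteSW₃ hWD₃)
  -- assemble
  exact rootChainF_of_bridgeS₃ hlipφ hlipc hwsc hlipL hlipL₃ P t Λ b₀ q δc du hσ hRQ hRB hRQ' hRM htA (hzconn t) hAπ hZfoot hZk hZk₁ B hB S₂ S₃ P₁ P₂ P₃
    rfl rfl rfl rfl rfl rfl (fun k => rootRim_subset t Rπ Pb.r₀ _) (fun k => rootRim_subset t Rπ Pk.r₀ _) (fun k => rootRim_subset t Rπ Pk.r₀ _)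
    hRl₁ hRl₂ hRl₃ hj₁ hj₂ hj₂ hfoot₁ hfoot₂ hfoot₃ hclear₁ hclear₂ hclear₃ hTne₁ hTne₂ hTne₃ hx hx₂ hlastf hlink hQπ hQfoot hT₀
    hcount₁ hcount₂ hcount₂ hkits₁ hkits₂ hkits₃ hη hexc₁ hexc₂ hexc₃

end Skelφ

end Transplant

end Summit.CriticalPhenomena.PercolationContinuityZ3.Theorems

end
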